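import Summits.ResolutionOfSingularities.ResolutionOfSingularities.Theorems.EquisingularLiftEquisingularLiftNatLinearCentre
import HarnessLib

/-!
# [OURS · L1 W4.5(b)] EL♮ helper (R1, part 3) — LINEAR CENTRES OVER `O`: points of the `k`-linear subspace, non-vanishing

Cell res-hironaka, LADDER-RESOLUTION rung L (D-0089), slot W4.5(b), crux `Theses.EquisingularLift.EquisingularLiftNat`
(stmt-ResolutionOfSingularities-20038), object **(R1)** of res-L1-w45b-plan-1's ORDERS 2026-08-27T05:49:16Z (P5, P7 of the
SIGNATURE 06:02:48Z), `--supports stmt-ResolutionOfSingularities-20038 --as helper`. NOT a statement of any manuscript; OURS.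
AI-written; AI review is weaker than expert review. Setting and notation: `…NatLinearCentre.lean` (part 2).

* `support_ker_eq_range` — `supp Λ_k = range (Proj f_k)` (closed immersion);
* `projMap_apply_asHomogeneousIdeal` — on points `Proj.map` is the inverse image of homogeneous primes (`rfl`);
* `mem_asHomogeneousIdeal_of_mem_support`, `X_mem_asHomogeneousIdeal_of_mem_support`, `not_mem_support_of_X_not_mem` —
  every form killed by `f_k` (in particular `x_i`, `i ∉ range e`) lies in the homogeneous prime of every point of `supp Λ_k`;
  the currency in which consumers check «the `k`-linear subspace lies on `H = V₊(F)`» (`f_k F = 0`) and «`H ⊄ supp Λ_k`»;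
* `ker_ne_bot_k`, `ker_ne_bot` — `Λ_k ≠ 0` (chart `D₊(x_{e 0})`: the section `x_i/x_{e 0}`, `i ∉ range e`, is non-zero, `k` a
  domain) and hence `Λ ≠ 0` (`Λ_k = Λ · 𝒪_{ℙ_k}`), as `IsBlowup.isIntegral` / `surjective_of_isBlowup` want.

References: [Hartshorne1977, II Prop. 5.9, Ex. 3.12 (a)].
-/

set_option linter.dupNamespace false -- mandated namespace `Summit.<Summit>.<Problem>` of this single-conjunct summit

noncomputable section

open CategoryTheory CategoryTheory.Limits AlgebraicGeometry TopologicalSpace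
open MvPolynomial HomogeneousLocalization
open Literature.AlgebraicGeometry.Resolution
open AlgebraicGeometry.Scheme.IdealSheafData
open Summit.ResolutionOfSingularities.ResolutionOfSingularities.Cruxes.EquisingularLift.StrataSplit

attribute [local instance] MvPolynomial.gradedAlgebra

namespace Summit.ResolutionOfSingularities.ResolutionOfSingularities.Cruxes.EquisingularLiftNat

namespace LinearCentre

/-! ## Points of the `k`-linear subspace -/

section Points

variable {k : Type} [CommRing k] {N r : ℕ} (e : Fin (r + 1) → Fin (N + 1))
  (fk : (homogeneousSubmodule (Fin (N + 1)) k) →+*ᵍ (homogeneousSubmodule (Fin (r + 1)) k))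
  (hfk' : HomogeneousIdeal.irrelevant (homogeneousSubmodule (Fin (r + 1)) k) ≤
    (HomogeneousIdeal.irrelevant (homogeneousSubmodule (Fin (N + 1)) k)).map fk)
  (hfkC : ∀ a : k, fk (C a) = C a) (hfke : ∀ j : Fin (r + 1), fk (X (e j)) = X j)

include hfkC hfke in
/-- `supp Λ_k = range (Proj f_k)` (the range of a closed immersion is closed). [folklore] -/
theorem support_ker_eq_range :
    ((Proj.map fk hfk').ker.support : Set (Proj (homogeneousSubmodule (Fin (N + 1)) k))) =
      Set.range (Proj.map fk hfk') := by
  haveI := isClosedImmersion_projMap_kill e fk hfk' hfkC hfke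
  rw [Scheme.Hom.support_ker, (Proj.map fk hfk').isClosedEmbedding.isClosed_range.closure_eq]

/-- On points `Proj.map` is the inverse image of homogeneous primes. [folklore] -/
theorem projMap_apply_asHomogeneousIdeal {A B σ τ : Type} [CommRing A] [CommRing B] [SetLike σ A]
    [AddSubgroupClass σ A] [SetLike τ B] [AddSubgroupClass τ B] {𝒜 : ℕ → σ} {ℬ : ℕ → τ} [GradedRing 𝒜]
    [GradedRing ℬ] (f : 𝒜 →+*ᵍ ℬ) (hf : HomogeneousIdeal.irrelevant ℬ ≤ (HomogeneousIdeal.irrelevant 𝒜).map f)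
    (z : Proj ℬ) : ((Proj.map f hf) z).asHomogeneousIdeal = z.asHomogeneousIdeal.comap f :=
  rfl

include hfkC hfke in
/-- **Forms killed by `f_k` vanish on the `k`-linear subspace**: for `y ∈ supp Λ_k` and `f_k G = 0` (e.g. `G = x_i`,
`i ∉ range e`, or any form in the ideal of the killed variables), `G` lies in the homogeneous prime of `y`. [folklore] -/
theorem mem_asHomogeneousIdeal_of_mem_support {y : Proj (homogeneousSubmodule (Fin (N + 1)) k)}
    (hy : y ∈ ((Proj.map fk hfk').ker.support : Set (Proj (homogeneousSubmodule (Fin (N + 1)) k))))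
    {G : MvPolynomial (Fin (N + 1)) k} (hG : fk G = 0) : G ∈ y.asHomogeneousIdeal := by
  rw [support_ker_eq_range e fk hfk' hfkC hfke] at hy
  obtain ⟨z, rfl⟩ := hy
  rw [projMap_apply_asHomogeneousIdeal]
  change fk G ∈ z.asHomogeneousIdeal
  rw [hG]
  exact zero_mem _

include hfkC hfke in
/-- In particular the killed variables vanish on `supp Λ_k`. [folklore] -/
theorem X_mem_asHomogeneousIdeal_of_mem_support (hfk0 : ∀ i : Fin (N + 1), i ∉ Set.range e → fk (X i) = 0)
    {y : Proj (homogeneousSubmodule (Fin (N + 1)) k)}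
    (hy : y ∈ ((Proj.map fk hfk').ker.support : Set (Proj (homogeneousSubmodule (Fin (N + 1)) k))))
    {i : Fin (N + 1)} (hi : i ∉ Set.range e) : (X i : MvPolynomial (Fin (N + 1)) k) ∈ y.asHomogeneousIdeal :=
  mem_asHomogeneousIdeal_of_mem_support e fk hfk' hfkC hfke hy (hfk0 i hi)

include hfkC hfke in
/-- A point at which some killed variable does NOT vanish is off `supp Λ_k`. [folklore] -/
theorem not_mem_support_of_X_not_mem (hfk0 : ∀ i : Fin (N + 1), i ∉ Set.range e → fk (X i) = 0)
    {y : Proj (homogeneousSubmodule (Fin (N + 1)) k)} {i : Fin (N + 1)} (hi : i ∉ Set.range e)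
    (hX : (X i : MvPolynomial (Fin (N + 1)) k) ∉ y.asHomogeneousIdeal) :
    y ∉ ((Proj.map fk hfk').ker.support : Set (Proj (homogeneousSubmodule (Fin (N + 1)) k))) :=
  fun hy => hX (X_mem_asHomogeneousIdeal_of_mem_support e fk hfk' hfkC hfke hfk0 hy hi)

include hfkC hfke in
/-- **The `k`-linear centre is a non-zero ideal sheaf** as soon as some variable is killed (`k` a domain): over the chart
`D₊(x_{e 0})` its ideal contains `x_i / x_{e 0} ≠ 0`. [folklore] -/
theorem ker_ne_bot_k [IsDomain k] (hfk0 : ∀ i : Fin (N + 1), i ∉ Set.range e → fk (X i) = 0)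
    {i : Fin (N + 1)} (hi : i ∉ Set.range e) : (Proj.map fk hfk').ker ≠ ⊥ := by
  intro hbot
  have hXk : ∀ i : Fin (N + 1), (X i : MvPolynomial (Fin (N + 1)) k) ∈ (homogeneousSubmodule (Fin (N + 1)) k) 1 :=
    fun i => isHomogeneous_X k i
  have hsurj : Function.Surjective fk := fun q => ⟨_, kill_rename e fk.toRingHom (fun a => hfkC a) (fun j => hfke j) q⟩
  have h := ker_projMap_ideal_basicOpen fk hfk' hsurj one_pos (hXk (e 0))
  rw [hbot, Scheme.IdealSheafData.ideal_bot, Pi.bot_apply] at h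
  have hXi : (X i : MvPolynomial (Fin (N + 1)) k) ∈ (homogeneousSubmodule (Fin (N + 1)) k) (1 • 1) := by
    simpa using hXk i
  have hmem : Away.mk (homogeneousSubmodule (Fin (N + 1)) k) (hXk (e 0)) 1 (X i) hXi ∈
      awayIdeal (homogeneousSubmodule (Fin (N + 1)) k) (hXk (e 0)) (RingHom.ker fk) :=
    mk_mem_awayIdeal _ _ hXi (RingHom.mem_ker.mpr (hfk0 i hi))
  have hzero : (Proj.awayToSection (homogeneousSubmodule (Fin (N + 1)) k) (X (e 0))).hom
      (Away.mk (homogeneousSubmodule (Fin (N + 1)) k) (hXk (e 0)) 1 (X i) hXi) = 0 := by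
    have := Ideal.mem_map_of_mem (Proj.awayToSection (homogeneousSubmodule (Fin (N + 1)) k) (X (e 0))).hom hmem
    rw [← h] at this
    simpa using this
  have hinj : Function.Injective (Proj.awayToSection (homogeneousSubmodule (Fin (N + 1)) k) (X (e 0))).hom :=
    (ConcreteCategory.bijective_of_isIso
      (Proj.basicOpenIsoAway (homogeneousSubmodule (Fin (N + 1)) k) (X (e 0)) (hXk (e 0)) one_pos).hom).1
  have hmk : Away.mk (homogeneousSubmodule (Fin (N + 1)) k) (hXk (e 0)) 1 (X i) hXi = 0 :=
    hinj (hzero.trans (map_zero _).symm)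
  rw [Away.mk_eq_zero_iff] at hmk
  obtain ⟨m, hm⟩ := hmk
  exact (mul_ne_zero (pow_ne_zero m (X_ne_zero (e 0))) (X_ne_zero i)) hm

end Points

/-! ## Non-vanishing over `O` -/

section NeBot

variable {O k : Type} [CommRing O] [Field k] (π : O →+* k) (hπ : Function.Surjective π) {N r : ℕ}
  (e : Fin (r + 1) → Fin (N + 1))
  (φ : (homogeneousSubmodule (Fin (N + 1)) O) →+*ᵍ (homogeneousSubmodule (Fin (N + 1)) k))
  (hφ : ∀ q, φ q = MvPolynomial.map π q)
  (hφ' : HomogeneousIdeal.irrelevant (homogeneousSubmodule (Fin (N + 1)) k) ≤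
    (HomogeneousIdeal.irrelevant (homogeneousSubmodule (Fin (N + 1)) O)).map φ)
  (fO : (homogeneousSubmodule (Fin (N + 1)) O) →+*ᵍ (homogeneousSubmodule (Fin (r + 1)) O))
  (hfO' : HomogeneousIdeal.irrelevant (homogeneousSubmodule (Fin (r + 1)) O) ≤
    (HomogeneousIdeal.irrelevant (homogeneousSubmodule (Fin (N + 1)) O)).map fO)
  (hfOC : ∀ a : O, fO (C a) = C a) (hfOe : ∀ j : Fin (r + 1), fO (X (e j)) = X j)
  (hfO0 : ∀ i : Fin (N + 1), i ∉ Set.range e → fO (X i) = 0)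
  (fk : (homogeneousSubmodule (Fin (N + 1)) k) →+*ᵍ (homogeneousSubmodule (Fin (r + 1)) k))
  (hfk' : HomogeneousIdeal.irrelevant (homogeneousSubmodule (Fin (r + 1)) k) ≤
    (HomogeneousIdeal.irrelevant (homogeneousSubmodule (Fin (N + 1)) k)).map fk)
  (hfkC : ∀ a : k, fk (C a) = C a) (hfke : ∀ j : Fin (r + 1), fk (X (e j)) = X j)
  (hfk0 : ∀ i : Fin (N + 1), i ∉ Set.range e → fk (X i) = 0)

include hφ hφ' hfOC hfOe hfO0 hfk' hfkC hfke hfk0 hπ in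
/-- **The linear centre over `O` is a non-zero ideal sheaf** as soon as some variable is killed:
`Λ · 𝒪_{ℙ_k} = Λ_k ≠ 0`. [folklore] -/
theorem ker_ne_bot {i : Fin (N + 1)} (hi : i ∉ Set.range e) : (Proj.map fO hfO').ker ≠ ⊥ := by
  intro hbot
  apply ker_ne_bot_k e fk hfk' hfkC hfke hfk0 hi
  rw [ker_projMap_kill_eq_comap π hπ e φ hφ hφ' fO hfO' hfOC hfOe hfO0 fk hfk' hfkC hfke hfk0, hbot,
    Scheme.IdealSheafData.comap_bot]

end NeBot

end LinearCentre

end Summit.ResolutionOfSingularities.ResolutionOfSingularities.Cruxes.EquisingularLiftNat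

end
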